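/-
Copyright (c) 2026. All rights reserved.
Released under Apache 2.0 license as described in the file LICENSE.
Authors: HodgeCM publication cell (pub-hodgecm), DAG-node prover lineage #14 (gen 6: statements and proofs;
gen 7: tree port).
-/
import Mathlib.Analysis.Distribution.SchwartzSpace.Deriv
import Mathlib.Analysis.Calculus.MeanValue
import HarnessLib

/-!
# Schwartz seminorms of `Φ ∘ L - Φ` for a linear map `L` close to the identity

Topic `Analysis/Distribution`; namespace `Literature.Analysis.Distribution`.  Let `E`, `F` be real normed spaces,
`Φ ∈ 𝓢(E, F)` a Schwartz function and `L : E →L[ℝ] E` a continuous linear map with `‖L - 1‖ ≤ 1/2`.  This file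
proves the two elementary estimates which, fed into the bounded-plus-uniform criterion of
`SchwartzBoundedConvergence`, give the Schwartz-topology derivative of every linear flow `s ↦ Φ ∘ L(s)`
(file `SchwartzLinearFlowDeriv`):

* `seminorm_compCLM_sub_le` — **every Schwartz seminorm of `Φ ∘ L - Φ` is `O(‖L - 1‖)`**:
  `p_{k,n}(Φ ∘ L - Φ) ≤ (2^(n+k+1) p_{k+1,n+1}(Φ) + n 2^n p_{k,n}(Φ)) ‖L - 1‖`.  Mean value inequality for `DⁿΦ`
  on the ball `closedBall x (‖x‖/2)` — where the Schwartz decay of `Dⁿ⁺¹Φ` is still available with the weight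
  `‖x‖^k` (`pow_mul_norm_iteratedFDeriv_le_of_near`) — plus the multilinear estimate
  `‖M ∘ (L, …, L) - M‖ ≤ ‖M‖ · n · 2^n · ‖L - 1‖` (`norm_compContinuousLinearMap_sub_self_le`);
* `norm_comp_sub_sub_fderiv_le` — the **uniform second-order Taylor estimate**
  `‖Φ(Lx) - Φ(x) - DΦ(x)(Lx - x)‖ ≤ 4 p_{2,2}(Φ) ‖L - 1‖²`, uniformly in `x ∈ E`.

Also defined here: the generator `flowGen A : 𝓢(E, F) →L[ℝ] 𝓢(E, F)`, `flowGen A Φ x = DΦ(x)[A x]`, of the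
composition flow `Φ ↦ Φ ∘ (1 + s A + o(s))` — for `A = 1` the Euler operator `x · ∇`, for `A` nilpotent /
semisimple the infinitesimal Levi and Cartan directions of the metaplectic (oscillator) representation on `𝓢`
(G. B. Folland, *Harmonic Analysis in Phase Space* (1989), Ch. 4 [Folland1989]; the Schwartz space as the space
of smooth vectors: M. Reed, B. Simon, *Methods of Modern Mathematical Physics I*, §V.3 [ReedSimonI1980];
L. Hörmander, *ALPDO I*, §7.1 [HormanderALPDO1]).  All statements are standard real analysis with explicit
constants; we know no reference stating them in this form, hence the `folklore` tags.

Design: `L` is a bare continuous linear map in the pointwise estimates and a `ContinuousLinearEquiv` only where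
Mathlib's `SchwartzMap.compCLMOfContinuousLinearEquiv` is invoked; the scalar field `𝕜` of that operator is a
parameter.  NOT here: the limit statements (`SchwartzLinearFlowDeriv`), translations (`SchwartzTranslationFlowDeriv`).

Provenance: tree port (LEAN-IN-TREE, 2026-08-18) of §§1–4 of the HodgeCM publication cell's package file
`HodgeCM/Automorphic/SchwartzLinearFlowDeriv.lean` (unit `pub-hodgecm-pv14-g6`, gate run 31; namespace
`HodgeCM.SchwartzWeil` ↦ `Literature.Analysis.Distribution`, statements verbatim).  Nothing in this file is
specific to that cell or under adjudication there.
-/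

set_option autoImplicit false

noncomputable section

open scoped SchwartzMap Topology
open Filter Set Metric

namespace Literature.Analysis.Distribution

variable {E F : Type*} [NormedAddCommGroup E] [NormedSpace ℝ E] [NormedAddCommGroup F] [NormedSpace ℝ F]

/-! ## The generator `Φ ↦ (x ↦ DΦ(x)[A x])` -/

/-- The infinitesimal generator of the composition flow `Φ ↦ Φ ∘ L(s)` for `L(s) = 1 + s A + o(s)`:
`flowGen A Φ x = DΦ(x) (A x)`, as a continuous linear endomorphism of `𝓢(E, F)` (Mathlib's `bilinLeftCLM`
applied to `DΦ ∈ 𝓢(E, E →L F)` and the temperate-growth function `A`). [folklore] -/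
def flowGen (A : E →L[ℝ] E) : 𝓢(E, F) →L[ℝ] 𝓢(E, F) :=
  (SchwartzMap.bilinLeftCLM (ContinuousLinearMap.id ℝ (E →L[ℝ] F)) A.hasTemperateGrowth).comp
    (SchwartzMap.fderivCLM ℝ E F)

/-- `flowGen A Φ x = DΦ(x)[A x]`. [folklore] -/
@[simp] theorem flowGen_apply (A : E →L[ℝ] E) (Φ : 𝓢(E, F)) (x : E) :
    flowGen A Φ x = fderiv ℝ Φ x (A x) := rfl

/-! ## Elementary operator-norm facts -/

/-- `‖L x - x‖ ≤ ‖L - 1‖ ‖x‖`. [folklore] -/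
theorem norm_apply_sub_self_le (L : E →L[ℝ] E) (x : E) : ‖L x - x‖ ≤ ‖L - 1‖ * ‖x‖ := by
  have h : L x - x = (L - 1) x := by simp
  rw [h]
  exact (L - 1).le_opNorm x

/-- `‖L - 1‖ ≤ 1/2` implies `‖L‖ ≤ 2`. [folklore] -/
theorem norm_le_two_of_norm_sub_one_le {L : E →L[ℝ] E} (hL : ‖L - 1‖ ≤ 1 / 2) : ‖L‖ ≤ 2 := by
  have h1 : ‖(1 : E →L[ℝ] E)‖ ≤ 1 := ContinuousLinearMap.norm_id_le
  have h2 : ‖L‖ ≤ ‖(1 : E →L[ℝ] E)‖ + ‖L - 1‖ := by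
    have := norm_add_le (1 : E →L[ℝ] E) (L - 1)
    rwa [add_sub_cancel] at this
  linarith

/-! ## Local weighted bounds: Schwartz decay survives on the ball `closedBall x (‖x‖/2)` -/

/-- If `‖z - x‖ ≤ ‖x‖ / 2` then `‖x‖ ≤ 2 ‖z‖`, hence `‖x‖^k ‖DⁿΦ(z)‖ ≤ 2^k p_{k,n}(Φ)`. [folklore] -/
theorem pow_mul_norm_iteratedFDeriv_le_of_near (Φ : 𝓢(E, F)) (k n : ℕ) {x z : E}
    (hz : ‖z - x‖ ≤ ‖x‖ / 2) :
    ‖x‖ ^ k * ‖iteratedFDeriv ℝ n Φ z‖ ≤ 2 ^ k * SchwartzMap.seminorm ℝ k n Φ := by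
  have hxz : ‖x‖ ≤ 2 * ‖z‖ := by
    have h1 : ‖x‖ ≤ ‖z‖ + ‖x - z‖ := norm_le_insert' x z
    rw [norm_sub_rev] at h1
    linarith
  calc ‖x‖ ^ k * ‖iteratedFDeriv ℝ n Φ z‖ ≤ (2 * ‖z‖) ^ k * ‖iteratedFDeriv ℝ n Φ z‖ := by gcongr
    _ = 2 ^ k * (‖z‖ ^ k * ‖iteratedFDeriv ℝ n Φ z‖) := by rw [mul_pow]; ring
    _ ≤ 2 ^ k * SchwartzMap.seminorm ℝ k n Φ := by
        gcongr
        exact SchwartzMap.le_seminorm ℝ k n Φ z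

/-! ## Schwartz seminorms of `Φ ∘ L - Φ` are `O(‖L - 1‖)` -/

section CompEstimates

variable (Φ : 𝓢(E, F))

/-- Mean-value step with Schwartz decay: for `‖L - 1‖ ≤ 1/2`,
`‖x‖^k ‖DⁿΦ(Lx) - DⁿΦ(x)‖ ≤ 2^(k+1) p_{k+1,n+1}(Φ) ‖L - 1‖`. [folklore] -/
theorem pow_mul_norm_iteratedFDeriv_apply_sub_le {L : E →L[ℝ] E} (hL : ‖L - 1‖ ≤ 1 / 2) (k n : ℕ)
    (x : E) :
    ‖x‖ ^ k * ‖iteratedFDeriv ℝ n Φ (L x) - iteratedFDeriv ℝ n Φ x‖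
      ≤ 2 ^ (k + 1) * SchwartzMap.seminorm ℝ (k + 1) (n + 1) Φ * ‖L - 1‖ := by
  have hp : 0 ≤ SchwartzMap.seminorm ℝ (k + 1) (n + 1) Φ := apply_nonneg _ _
  have hL0 : 0 ≤ ‖L - 1‖ := norm_nonneg _
  by_cases hx : x = 0
  · subst hx
    simp only [map_zero, sub_self, norm_zero, mul_zero]
    exact mul_nonneg (mul_nonneg (pow_nonneg (by norm_num) _) hp) hL0
  have hxpos : 0 < ‖x‖ := norm_pos_iff.mpr hx
  have hxk : 0 < ‖x‖ ^ (k + 1) := pow_pos hxpos _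
  have hd : Differentiable ℝ (iteratedFDeriv ℝ n (Φ : E → F)) :=
    (Φ.smooth (n + 1 : ℕ)).differentiable_iteratedFDeriv (by exact_mod_cast Nat.lt_succ_self n)
  have hB : ∀ z ∈ closedBall x (‖x‖ / 2),
      ‖fderiv ℝ (iteratedFDeriv ℝ n (Φ : E → F)) z‖
        ≤ 2 ^ (k + 1) * SchwartzMap.seminorm ℝ (k + 1) (n + 1) Φ / ‖x‖ ^ (k + 1) := by
    intro z hz
    rw [mem_closedBall, dist_eq_norm] at hz
    rw [norm_fderiv_iteratedFDeriv, le_div_iff₀ hxk, mul_comm]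
    exact pow_mul_norm_iteratedFDeriv_le_of_near Φ (k + 1) (n + 1) hz
  have hLx : L x ∈ closedBall x (‖x‖ / 2) := by
    rw [mem_closedBall, dist_eq_norm]
    calc ‖L x - x‖ ≤ ‖L - 1‖ * ‖x‖ := norm_apply_sub_self_le L x
      _ ≤ 1 / 2 * ‖x‖ := by gcongr
      _ = ‖x‖ / 2 := by ring
  have hmv := (convex_closedBall x (‖x‖ / 2)).norm_image_sub_le_of_norm_fderiv_le
    (fun z _ => hd.differentiableAt) hB (mem_closedBall_self (by positivity)) hLx
  have hC : 0 ≤ 2 ^ (k + 1) * SchwartzMap.seminorm ℝ (k + 1) (n + 1) Φ / ‖x‖ ^ (k + 1) :=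
    div_nonneg (mul_nonneg (pow_nonneg (by norm_num) _) hp) hxk.le
  have hmv' : ‖iteratedFDeriv ℝ n Φ (L x) - iteratedFDeriv ℝ n Φ x‖
      ≤ 2 ^ (k + 1) * SchwartzMap.seminorm ℝ (k + 1) (n + 1) Φ / ‖x‖ ^ (k + 1) * (‖L - 1‖ * ‖x‖) :=
    hmv.trans (mul_le_mul_of_nonneg_left (norm_apply_sub_self_le L x) hC)
  calc ‖x‖ ^ k * ‖iteratedFDeriv ℝ n Φ (L x) - iteratedFDeriv ℝ n Φ x‖
      ≤ ‖x‖ ^ k * (2 ^ (k + 1) * SchwartzMap.seminorm ℝ (k + 1) (n + 1) Φ / ‖x‖ ^ (k + 1)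
          * (‖L - 1‖ * ‖x‖)) := by gcongr
    _ = 2 ^ (k + 1) * SchwartzMap.seminorm ℝ (k + 1) (n + 1) Φ * ‖L - 1‖ := by
        field_simp
        ring

/-- The multilinear estimate: for an `n`-linear map `M` and `‖L‖ ≤ 2`,
`‖M ∘ (L, …, L) - M‖ ≤ ‖M‖ · n · 2^n · ‖L - 1‖` (Mathlib's `ContinuousMultilinearMap.norm_image_sub_le` for
the map `compContinuousLinearMapLRight M`). [folklore] -/
theorem norm_compContinuousLinearMap_sub_self_le {n : ℕ}
    (M : ContinuousMultilinearMap ℝ (fun _ : Fin n => E) F) {L : E →L[ℝ] E} (hL : ‖L‖ ≤ 2) :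
    ‖M.compContinuousLinearMap (fun _ => L) - M‖ ≤ ‖M‖ * n * 2 ^ n * ‖L - 1‖ := by
  set f₁ : Fin n → (E →L[ℝ] E) := fun _ => L with hf₁
  set f₀ : Fin n → (E →L[ℝ] E) := fun _ => (1 : E →L[ℝ] E) with hf₀
  have h1 : M.compContinuousLinearMap f₀ = M := by
    ext v
    simp [f₀]
  have h2 : ‖M.compContinuousLinearMap f₁ - M‖
      = ‖ContinuousMultilinearMap.compContinuousLinearMapLRight M f₁
          - ContinuousMultilinearMap.compContinuousLinearMapLRight M f₀‖ := by
    rw [ContinuousMultilinearMap.compContinuousLinearMapLRight_apply,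
      ContinuousMultilinearMap.compContinuousLinearMapLRight_apply, h1]
  rw [h2]
  have key := (ContinuousMultilinearMap.compContinuousLinearMapLRight
    (E := fun _ : Fin n => E) M).norm_image_sub_le f₁ f₀
  rw [Fintype.card_fin] at key
  have hΨ : ‖ContinuousMultilinearMap.compContinuousLinearMapLRight (E := fun _ : Fin n => E) M‖ ≤ ‖M‖ :=
    ContinuousMultilinearMap.norm_compContinuousLinearMapLRight_le _ M
  have hn1 : ‖f₁‖ ≤ 2 := (pi_norm_const_le (ι := Fin n) L).trans hL
  have hn0 : ‖f₀‖ ≤ 2 :=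
    (pi_norm_const_le (ι := Fin n) (1 : E →L[ℝ] E)).trans
      (ContinuousLinearMap.norm_id_le.trans (by norm_num))
  have hmax : max ‖f₁‖ ‖f₀‖ ≤ 2 := max_le hn1 hn0
  have hpow : max ‖f₁‖ ‖f₀‖ ^ (n - 1) ≤ 2 ^ n :=
    (pow_le_pow_left₀ (by positivity) hmax _).trans (pow_le_pow_right₀ (by norm_num) (Nat.sub_le n 1))
  have hsub : ‖f₁ - f₀‖ ≤ ‖L - 1‖ := pi_norm_const_le (ι := Fin n) (L - 1)
  refine key.trans ?_
  have hM : 0 ≤ ‖M‖ := norm_nonneg _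
  calc ‖ContinuousMultilinearMap.compContinuousLinearMapLRight (E := fun _ : Fin n => E) M‖ * n
        * max ‖f₁‖ ‖f₀‖ ^ (n - 1) * ‖f₁ - f₀‖
      ≤ ‖M‖ * n * 2 ^ n * ‖L - 1‖ := by
        apply mul_le_mul _ hsub (norm_nonneg _) (by positivity)
        apply mul_le_mul _ hpow (by positivity) (by positivity)
        exact mul_le_mul_of_nonneg_right hΨ (Nat.cast_nonneg n)

/-- Pointwise weighted estimate for the `n`-th derivative of `Φ ∘ L - Φ` (`‖L - 1‖ ≤ 1/2`):
`‖x‖^k ‖Dⁿ(Φ ∘ L)(x) - DⁿΦ(x)‖ ≤ (2^(n+k+1) p_{k+1,n+1}(Φ) + n 2^n p_{k,n}(Φ)) ‖L - 1‖`. [folklore] -/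
theorem pow_mul_norm_iteratedFDeriv_comp_sub_le {L : E →L[ℝ] E} (hL : ‖L - 1‖ ≤ 1 / 2) (k n : ℕ)
    (x : E) :
    ‖x‖ ^ k * ‖iteratedFDeriv ℝ n ((Φ : E → F) ∘ L) x - iteratedFDeriv ℝ n Φ x‖ ≤
      (2 ^ (n + k + 1) * SchwartzMap.seminorm ℝ (k + 1) (n + 1) Φ
        + n * 2 ^ n * SchwartzMap.seminorm ℝ k n Φ) * ‖L - 1‖ := by
  have hL2 : ‖L‖ ≤ 2 := norm_le_two_of_norm_sub_one_le hL
  rw [L.iteratedFDeriv_comp_right (Φ.smooth n) x (i := n) (by exact_mod_cast le_rfl)]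
  have hsplit : (iteratedFDeriv ℝ n (Φ : E → F) (L x)).compContinuousLinearMap (fun _ => L)
        - iteratedFDeriv ℝ n Φ x
      = (iteratedFDeriv ℝ n (Φ : E → F) (L x) - iteratedFDeriv ℝ n Φ x).compContinuousLinearMap
          (fun _ => L)
        + ((iteratedFDeriv ℝ n (Φ : E → F) x).compContinuousLinearMap (fun _ => L)
          - iteratedFDeriv ℝ n Φ x) := by
    ext v
    simp only [sub_apply, add_apply, ContinuousMultilinearMap.compContinuousLinearMap_apply]
    abel
  rw [hsplit]
  have hA : ‖(iteratedFDeriv ℝ n (Φ : E → F) (L x) - iteratedFDeriv ℝ n Φ x).compContinuousLinearMap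
        (fun _ => L)‖ ≤ ‖iteratedFDeriv ℝ n (Φ : E → F) (L x) - iteratedFDeriv ℝ n Φ x‖ * 2 ^ n := by
    refine (ContinuousMultilinearMap.norm_compContinuousLinearMap_le _ _).trans ?_
    simp only [Finset.prod_const, Finset.card_univ, Fintype.card_fin]
    gcongr
  have hB := norm_compContinuousLinearMap_sub_self_le (iteratedFDeriv ℝ n (Φ : E → F) x) hL2
  have h1 := pow_mul_norm_iteratedFDeriv_apply_sub_le Φ hL k n x
  have h2 : ‖x‖ ^ k * ‖iteratedFDeriv ℝ n (Φ : E → F) x‖ ≤ SchwartzMap.seminorm ℝ k n Φ :=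
    SchwartzMap.le_seminorm ℝ k n Φ x
  have hp : 0 ≤ SchwartzMap.seminorm ℝ k n Φ := apply_nonneg _ _
  have hp' : 0 ≤ SchwartzMap.seminorm ℝ (k + 1) (n + 1) Φ := apply_nonneg _ _
  calc ‖x‖ ^ k * ‖(iteratedFDeriv ℝ n (Φ : E → F) (L x) - iteratedFDeriv ℝ n Φ x).compContinuousLinearMap
            (fun _ => L)
          + ((iteratedFDeriv ℝ n (Φ : E → F) x).compContinuousLinearMap (fun _ => L)
            - iteratedFDeriv ℝ n Φ x)‖
      ≤ ‖x‖ ^ k * (‖iteratedFDeriv ℝ n (Φ : E → F) (L x) - iteratedFDeriv ℝ n Φ x‖ * 2 ^ n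
          + ‖iteratedFDeriv ℝ n (Φ : E → F) x‖ * n * 2 ^ n * ‖L - 1‖) := by
        gcongr
        exact (norm_add_le _ _).trans (add_le_add hA hB)
    _ = 2 ^ n * (‖x‖ ^ k * ‖iteratedFDeriv ℝ n (Φ : E → F) (L x) - iteratedFDeriv ℝ n Φ x‖)
          + n * 2 ^ n * ‖L - 1‖ * (‖x‖ ^ k * ‖iteratedFDeriv ℝ n (Φ : E → F) x‖) := by ring
    _ ≤ 2 ^ n * (2 ^ (k + 1) * SchwartzMap.seminorm ℝ (k + 1) (n + 1) Φ * ‖L - 1‖)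
          + n * 2 ^ n * ‖L - 1‖ * SchwartzMap.seminorm ℝ k n Φ := by
        gcongr 2 ^ n * ?_ + _ * ?_
    _ = (2 ^ (n + k + 1) * SchwartzMap.seminorm ℝ (k + 1) (n + 1) Φ
          + n * 2 ^ n * SchwartzMap.seminorm ℝ k n Φ) * ‖L - 1‖ := by ring

/-- **Schwartz seminorms of `Φ ∘ L - Φ` are `O(‖L - 1‖)`**: for a linear automorphism `L` with
`‖L - 1‖ ≤ 1/2` and all `k n`,
`p_{k,n}(Φ ∘ L - Φ) ≤ (2^(n+k+1) p_{k+1,n+1}(Φ) + n 2^n p_{k,n}(Φ)) ‖L - 1‖`. [folklore] -/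
theorem seminorm_compCLM_sub_le (𝕜 : Type*) [RCLike 𝕜] [NormedSpace 𝕜 F] [SMulCommClass ℝ 𝕜 F]
    (L : E ≃L[ℝ] E) (hL : ‖(L : E →L[ℝ] E) - 1‖ ≤ 1 / 2) (k n : ℕ) :
    SchwartzMap.seminorm ℝ k n (SchwartzMap.compCLMOfContinuousLinearEquiv 𝕜 L Φ - Φ) ≤
      (2 ^ (n + k + 1) * SchwartzMap.seminorm ℝ (k + 1) (n + 1) Φ
        + n * 2 ^ n * SchwartzMap.seminorm ℝ k n Φ) * ‖(L : E →L[ℝ] E) - 1‖ := by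
  have hp : 0 ≤ SchwartzMap.seminorm ℝ k n Φ := apply_nonneg _ _
  have hp' : 0 ≤ SchwartzMap.seminorm ℝ (k + 1) (n + 1) Φ := apply_nonneg _ _
  refine SchwartzMap.seminorm_le_bound ℝ k n _
    (mul_nonneg (add_nonneg (mul_nonneg (pow_nonneg (by norm_num) _) hp')
      (mul_nonneg (mul_nonneg (Nat.cast_nonneg n) (pow_nonneg (by norm_num) _)) hp)) (norm_nonneg _))
    fun x => ?_
  have hcoe : ((SchwartzMap.compCLMOfContinuousLinearEquiv 𝕜 L Φ - Φ : 𝓢(E, F)) : E → F)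
      = ((Φ : E → F) ∘ (L : E →L[ℝ] E)) - (Φ : E → F) := by
    ext y
    simp
  rw [hcoe, iteratedFDeriv_sub_apply (((Φ.smooth n).comp (L : E →L[ℝ] E).contDiff).contDiffAt)
    ((Φ.smooth n).contDiffAt)]
  exact pow_mul_norm_iteratedFDeriv_comp_sub_le Φ hL k n x

/-! ## The uniform second-order Taylor estimate -/

/-- For `‖L - 1‖ ≤ 1/2` and every `x`:
`‖Φ(Lx) - Φ(x) - DΦ(x)(Lx - x)‖ ≤ 4 p_{2,2}(Φ) ‖L - 1‖²`, uniformly in `x` (two mean value inequalities on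
`closedBall x ‖Lx - x‖ ⊆ closedBall x (‖x‖/2)`, with `‖D²Φ‖ ≤ 4 p_{2,2}(Φ)/‖x‖²` there). [folklore] -/
theorem norm_comp_sub_sub_fderiv_le {L : E →L[ℝ] E} (hL : ‖L - 1‖ ≤ 1 / 2) (x : E) :
    ‖Φ (L x) - Φ x - fderiv ℝ Φ x (L x - x)‖ ≤ 4 * SchwartzMap.seminorm ℝ 2 2 Φ * ‖L - 1‖ ^ 2 := by
  have hp : 0 ≤ SchwartzMap.seminorm ℝ 2 2 Φ := apply_nonneg _ _
  by_cases hx : x = 0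
  · subst hx
    simp only [map_zero, sub_self, norm_zero]
    exact mul_nonneg (mul_nonneg (by norm_num) hp) (sq_nonneg _)
  have hxpos : 0 < ‖x‖ := norm_pos_iff.mpr hx
  have hx2 : 0 < ‖x‖ ^ 2 := pow_pos hxpos 2
  have hr : ‖L x - x‖ ≤ ‖L - 1‖ * ‖x‖ := norm_apply_sub_self_le L x
  have hr2 : ‖L x - x‖ ≤ ‖x‖ / 2 := by
    calc ‖L x - x‖ ≤ ‖L - 1‖ * ‖x‖ := hr
      _ ≤ 1 / 2 * ‖x‖ := by gcongr
      _ = ‖x‖ / 2 := by ring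
  have hdd : Differentiable ℝ (fderiv ℝ (Φ : E → F)) := (SchwartzMap.fderivCLM ℝ E F Φ).differentiable
  have hC : 0 ≤ 4 * SchwartzMap.seminorm ℝ 2 2 Φ / ‖x‖ ^ 2 := div_nonneg (by linarith) hx2.le
  -- second derivative bound on the small ball
  have hB : ∀ z ∈ closedBall x ‖L x - x‖,
      ‖fderiv ℝ (fderiv ℝ (Φ : E → F)) z‖ ≤ 4 * SchwartzMap.seminorm ℝ 2 2 Φ / ‖x‖ ^ 2 := by
    intro z hz
    rw [mem_closedBall, dist_eq_norm] at hz
    have h := pow_mul_norm_iteratedFDeriv_le_of_near Φ 2 2 (hz.trans hr2)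
    rw [← norm_iteratedFDeriv_one, norm_iteratedFDeriv_fderiv, le_div_iff₀ hx2, mul_comm]
    norm_num at h
    exact h
  -- hence `DΦ` is Lipschitz there with constant `4 p / ‖x‖²`
  have hLip : ∀ z ∈ closedBall x ‖L x - x‖,
      ‖fderiv ℝ (Φ : E → F) z - fderiv ℝ Φ x‖ ≤ 4 * SchwartzMap.seminorm ℝ 2 2 Φ / ‖x‖ ^ 2 * ‖L x - x‖ := by
    intro z hz
    have h := (convex_closedBall x ‖L x - x‖).norm_image_sub_le_of_norm_fderiv_le
      (fun w _ => hdd.differentiableAt) hB (mem_closedBall_self (norm_nonneg _)) hz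
    rw [mem_closedBall, dist_eq_norm] at hz
    exact h.trans (mul_le_mul_of_nonneg_left hz hC)
  have hT := (convex_closedBall x ‖L x - x‖).norm_image_sub_le_of_norm_fderiv_le'
    (fun w _ => Φ.differentiableAt) hLip (mem_closedBall_self (norm_nonneg _))
    (mem_closedBall_iff_norm.2 le_rfl)
  calc ‖Φ (L x) - Φ x - fderiv ℝ Φ x (L x - x)‖
      ≤ 4 * SchwartzMap.seminorm ℝ 2 2 Φ / ‖x‖ ^ 2 * ‖L x - x‖ * ‖L x - x‖ := hT
    _ ≤ 4 * SchwartzMap.seminorm ℝ 2 2 Φ / ‖x‖ ^ 2 * (‖L - 1‖ * ‖x‖) * (‖L - 1‖ * ‖x‖) := by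
        gcongr
    _ = 4 * SchwartzMap.seminorm ℝ 2 2 Φ * ‖L - 1‖ ^ 2 := by
        field_simp

/-- The weighted first-derivative bound `‖x‖ ‖DΦ(x)‖ ≤ p_{1,1}(Φ)`. [folklore] -/
theorem norm_mul_norm_fderiv_le (x : E) : ‖x‖ * ‖fderiv ℝ (Φ : E → F) x‖ ≤ SchwartzMap.seminorm ℝ 1 1 Φ := by
  have h := SchwartzMap.le_seminorm ℝ 1 1 Φ x
  rwa [pow_one, norm_iteratedFDeriv_one] at h

end CompEstimates

end Literature.Analysis.Distribution
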